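import Literature.Probability.RandomMatrix.ComplexGaussianNormSq
import Literature.MeasureTheory.TotalVariation.SetwiseBound
import HarnessLib

/-!
# Total variation between a contracted complex Gaussian vector and the standard one

For an `n × n` complex matrix `N` with `N Nᴴ ≤ 1` (a contraction) and `x ∼ γ^n` a standard
complex Gaussian vector, the law of `N x` is the centred complex Gaussian with covariance
`Σ = N Nᴴ`, and

  `‖Law(N x) − γ^n‖_TV ≤ 2 · tr(1 − N Nᴴ) = 2 (n − ∑ᵢⱼ |Nᵢⱼ|²)`

(`tvClose_gaussianPi_map_mulVec`). Proof: diagonalise `Σ = U D U†` (spectral theorem); by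
unitary invariance of `γ^n` one may replace `N` by `U† N`, whose rows are orthogonal with squared
norms the eigenvalues `σᵢ ∈ [0,1]`, so that `Law(U†N x) = ⊗ᵢ 𝒩_ℂ(0, σᵢ)`; tensorise
(`‖⊗μᵢ − ⊗νᵢ‖ ≤ ∑ ‖μᵢ − νᵢ‖`) and use the one-dimensional bound
`‖𝒩_ℂ(0,σ) − 𝒩_ℂ(0,1)‖_TV ≤ 2(1 − σ)` (`tvClose_stdComplexGaussian_smul`, from the density ratio
`σ⁻¹ e^{−|z|²(σ⁻¹−1)} ≥ 1 − |z|²(σ⁻¹ − 1)`).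

This is a weak (trace instead of Frobenius norm, constant `2`) form of the Gaussian
total-variation bound of Devroye–Mehrabian–Reddad.

## References

* L. Devroye, A. Mehrabian, T. Reddad, *The total variation distance between high-dimensional
  Gaussians with the same mean*, arXiv:1810.08693 (2018), Thm. 1.1 (two-sided bound with the
  Frobenius norm; the bound here is weaker since `‖1 − Σ‖_F ≤ tr(1 − Σ)` for `0 ≤ Σ ≤ 1`).
-/

open MeasureTheory ProbabilityTheory Complex WithLp Real Set Matrix
open scoped ENNReal NNReal ComplexOrder

namespace Literature.Probability.RandomMatrix

open Literature.Computability.QuantumComplexity (stdComplexGaussian stdComplexGaussianDensity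
  stdComplexGaussian_eq_withDensity continuous_stdComplexGaussianDensity
  stdComplexGaussianDensity_pos map_withDensity_equiv)
open Literature.MeasureTheory.TotalVariation

/-! ### One dimension: `‖𝒩_ℂ(0,σ) − 𝒩_ℂ(0,1)‖ ≤ 2(1 − σ)` -/

/-- `𝔼|z|² = 1` for the standard complex Gaussian: `∫ |z|² dγ = 1`. [folklore] -/
theorem lintegral_normSq_stdComplexGaussian :
    ∫⁻ z, ENNReal.ofReal (‖z‖ ^ 2) ∂stdComplexGaussian = 1 := by
  rw [lintegral_comp_normSq_stdComplexGaussian (fun t => ENNReal.ofReal t) ENNReal.measurable_ofReal]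
  have h2 := lintegral_gammaPDF_eq_one (a := 2) (r := 1) (by norm_num) one_pos
  rw [← lintegral_add_compl _ measurableSet_Ici] at h2
  have h0 : ∫⁻ x in (Ici (0:ℝ))ᶜ, gammaPDF 2 1 x = 0 := by
    rw [compl_Ici, setLIntegral_congr_fun measurableSet_Iio
      (fun x (hx : x < 0) => gammaPDF_of_neg hx), lintegral_zero]
  rw [h0, add_zero, setLIntegral_congr Ioi_ae_eq_Ici.symm] at h2
  rw [← h2]
  refine setLIntegral_congr_fun measurableSet_Ioi fun t (ht : 0 < t) => ?_
  rw [gammaPDF_of_nonneg ht.le, ← ENNReal.ofReal_mul ht.le]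
  congr 1
  have : Real.Gamma 2 = 1 := by
    rw [show (2:ℝ) = 1 + 1 by norm_num, Real.Gamma_add_one one_ne_zero, Real.Gamma_one, mul_one]
  rw [this]
  have h21 : (2:ℝ) - 1 = 1 := by norm_num
  rw [h21, Real.rpow_one, one_rpow]
  ring

/-- Lebesgue measure on `ℂ` under the real dilation `z ↦ c • z` (`c ≠ 0`):
`vol ∘ (c • ·)⁻¹ = c⁻² · vol`. [folklore] -/
theorem volume_map_real_smul_complex {c : ℝ} (hc : c ≠ 0) :
    (volume : Measure ℂ).map (fun z : ℂ => c • z) = ENNReal.ofReal ((c ^ 2)⁻¹) • volume := by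
  rw [Measure.map_addHaar_smul volume hc, Complex.finrank_real_complex]
  congr 2
  rw [abs_of_nonneg (by positivity)]

/-- The law of `√σ · z` for `z` standard complex Gaussian and `σ > 0` has density
`σ⁻¹ p(z/√σ) = (πσ)⁻¹ e^{−|z|²/σ}` (`p = π⁻¹e^{−|z|²}`). [folklore] -/
theorem stdComplexGaussian_map_smul_eq_withDensity {σ : ℝ} (hσ : 0 < σ) :
    stdComplexGaussian.map (fun z : ℂ => Real.sqrt σ • z) =
      volume.withDensity fun z =>
        ENNReal.ofReal (σ⁻¹ * stdComplexGaussianDensity ((Real.sqrt σ)⁻¹ • z)) := by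
  have hc : Real.sqrt σ ≠ 0 := (Real.sqrt_pos.2 hσ).ne'
  set e : ℂ ≃ᵐ ℂ := (Homeomorph.smulOfNeZero (Real.sqrt σ) hc).toMeasurableEquiv with he
  have hecoe : (fun z : ℂ => Real.sqrt σ • z) = e := rfl
  have hesymm : ∀ z, e.symm z = (Real.sqrt σ)⁻¹ • z := fun z => rfl
  have hdens : Measurable fun z : ℂ => ENNReal.ofReal (stdComplexGaussianDensity z) :=
    ENNReal.measurable_ofReal.comp continuous_stdComplexGaussianDensity.measurable
  rw [stdComplexGaussian_eq_withDensity, hecoe, map_withDensity_equiv, ← hecoe,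
    volume_map_real_smul_complex hc, Real.sq_sqrt hσ.le, withDensity_smul_measure,
    ← withDensity_smul _ (hdens.comp e.symm.measurable)]
  congr 1
  funext z
  simp only [Pi.smul_apply, Function.comp_apply, hesymm, smul_eq_mul]
  rw [← ENNReal.ofReal_mul (by positivity)]

/-- The pointwise density comparison behind the one-dimensional bound: for `s ≥ 1`, `a ≥ 0`,
`e^{−a} ≤ s e^{−sa} + a(s−1)e^{−a}` (from `e^{−y} ≥ 1 − y`). [folklore] -/
theorem exp_neg_le_mul_exp_add {s a : ℝ} (hs : 1 ≤ s) (_ha : 0 ≤ a) :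
    Real.exp (-a) ≤ s * Real.exp (-(s * a)) + a * (s - 1) * Real.exp (-a) := by
  have h1 : 1 - (s - 1) * a ≤ Real.exp (-((s - 1) * a)) := by
    have := Real.add_one_le_exp (-((s - 1) * a)); linarith
  have h2 : Real.exp (-(s * a)) = Real.exp (-a) * Real.exp (-((s - 1) * a)) := by
    rw [← Real.exp_add]; congr 1; ring
  have hpos : 0 < Real.exp (-a) := Real.exp_pos _
  have h3 : Real.exp (-(s * a)) ≥ Real.exp (-a) * (1 - (s - 1) * a) := by
    rw [h2]; exact mul_le_mul_of_nonneg_left h1 hpos.le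
  have h4 : s * Real.exp (-(s * a)) ≥ Real.exp (-(s * a)) := by
    have := Real.exp_pos (-(s * a)); nlinarith
  nlinarith

/-- **`‖𝒩_ℂ(0,σ) − 𝒩_ℂ(0,1)‖_TV ≤ 2(1 − σ)`** for `σ ≤ 1`: the law of `√σ · z` (`z` standard
complex Gaussian; `√σ = 0` for `σ ≤ 0`) is `2(1−σ)`-close to the law of `z` on every measurable
set. (For `σ ≥ 1/2` the density ratio `σ⁻¹e^{−|z|²(σ⁻¹−1)} ≥ 1 − |z|²(σ⁻¹−1)` gives the bound
`σ⁻¹ − 1 ≤ 2(1−σ)`; for `σ < 1/2` the trivial bound `1` suffices.) [folklore] -/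
theorem tvClose_stdComplexGaussian_smul {σ : ℝ} (h1 : σ ≤ 1) :
    TVClose (stdComplexGaussian.map fun z : ℂ => Real.sqrt σ • z) stdComplexGaussian
      (2 * (1 - σ)) := by
  have hmeas : Measurable fun z : ℂ => Real.sqrt σ • z := by fun_prop
  haveI : IsProbabilityMeasure (stdComplexGaussian.map fun z : ℂ => Real.sqrt σ • z) :=
    Measure.isProbabilityMeasure_map hmeas.aemeasurable
  by_cases hhalf : σ < 1 / 2
  · exact (TVClose.of_prob _ _).mono (by linarith)
  rw [not_lt] at hhalf
  have hσ : 0 < σ := by linarith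
  have hc : Real.sqrt σ ≠ 0 := (Real.sqrt_pos.2 hσ).ne'
  -- densities
  set p : ℂ → ℝ≥0∞ := fun z => ENNReal.ofReal (stdComplexGaussianDensity z) with hp
  set q : ℂ → ℝ≥0∞ := fun z =>
    ENNReal.ofReal (σ⁻¹ * stdComplexGaussianDensity ((Real.sqrt σ)⁻¹ • z)) with hq
  set ε : ℂ → ℝ≥0∞ := fun z => ENNReal.ofReal (‖z‖ ^ 2 * (σ⁻¹ - 1)) with hε
  have hpm : Measurable p :=
    ENNReal.measurable_ofReal.comp continuous_stdComplexGaussianDensity.measurable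
  have hqm : Measurable q := by
    refine ENNReal.measurable_ofReal.comp (measurable_const.mul ?_)
    exact continuous_stdComplexGaussianDensity.measurable.comp (by fun_prop)
  have hμ : stdComplexGaussian.map (fun z : ℂ => Real.sqrt σ • z) = volume.withDensity q :=
    stdComplexGaussian_map_smul_eq_withDensity hσ
  have hγ : stdComplexGaussian = volume.withDensity p := stdComplexGaussian_eq_withDensity
  haveI : IsProbabilityMeasure (volume.withDensity q) := hμ ▸ inferInstance
  haveI : IsProbabilityMeasure (volume.withDensity p) := hγ ▸ inferInstance
  -- the pointwise comparison `p ≤ q + ε p`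
  have hs1 : 0 ≤ σ⁻¹ - 1 := by rw [sub_nonneg]; exact one_le_inv_iff₀.2 ⟨hσ, h1⟩
  have hle : ∀ z, p z ≤ q z + ε z * p z := by
    intro z
    have hp0 : 0 ≤ stdComplexGaussianDensity z := (stdComplexGaussianDensity_pos z).le
    have hq0 : 0 ≤ σ⁻¹ * stdComplexGaussianDensity ((Real.sqrt σ)⁻¹ • z) := by
      have := stdComplexGaussianDensity_pos ((Real.sqrt σ)⁻¹ • z); positivity
    have hε0 : 0 ≤ ‖z‖ ^ 2 * (σ⁻¹ - 1) := mul_nonneg (sq_nonneg _) hs1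
    simp only [hp, hq, hε]
    rw [← ENNReal.ofReal_mul hε0, ← ENNReal.ofReal_add hq0 (mul_nonneg hε0 hp0)]
    refine ENNReal.ofReal_le_ofReal ?_
    simp only [stdComplexGaussianDensity]
    have hns : ‖(Real.sqrt σ)⁻¹ • z‖ ^ 2 = σ⁻¹ * ‖z‖ ^ 2 := by
      rw [norm_smul, mul_pow, Real.norm_eq_abs, abs_inv, abs_of_nonneg (Real.sqrt_nonneg σ),
        inv_pow, Real.sq_sqrt hσ.le]
    rw [hns]
    have hs : 1 ≤ σ⁻¹ := one_le_inv_iff₀.2 ⟨hσ, h1⟩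
    have key := exp_neg_le_mul_exp_add hs (sq_nonneg ‖z‖)
    have hpi : 0 < π⁻¹ := by positivity
    calc π⁻¹ * Real.exp (-‖z‖ ^ 2)
        ≤ π⁻¹ * (σ⁻¹ * Real.exp (-(σ⁻¹ * ‖z‖ ^ 2)) + ‖z‖ ^ 2 * (σ⁻¹ - 1) * Real.exp (-‖z‖ ^ 2)) :=
          mul_le_mul_of_nonneg_left key hpi.le
      _ = σ⁻¹ * (π⁻¹ * Real.exp (-(σ⁻¹ * ‖z‖ ^ 2))) +
          ‖z‖ ^ 2 * (σ⁻¹ - 1) * (π⁻¹ * Real.exp (-‖z‖ ^ 2)) := by ring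
  -- the integral of `ε p`
  have hint : ∫⁻ z, ε z * p z ∂volume = ENNReal.ofReal (σ⁻¹ - 1) := by
    have hεm : Measurable ε := by fun_prop
    calc ∫⁻ z, ε z * p z ∂volume = ∫⁻ z, (p * ε) z ∂volume := by
          refine lintegral_congr fun z => ?_; rw [Pi.mul_apply, mul_comm]
      _ = ∫⁻ z, ε z ∂stdComplexGaussian := by
          rw [hγ, lintegral_withDensity_eq_lintegral_mul _ hpm hεm]
      _ = ∫⁻ z, ENNReal.ofReal (σ⁻¹ - 1) * ENNReal.ofReal (‖z‖ ^ 2) ∂stdComplexGaussian := by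
          refine lintegral_congr fun z => ?_
          simp only [hε]; rw [mul_comm (‖z‖ ^ 2), ENNReal.ofReal_mul hs1]
      _ = ENNReal.ofReal (σ⁻¹ - 1) := by
          rw [lintegral_const_mul _ (by fun_prop), lintegral_normSq_stdComplexGaussian, mul_one]
  have hfin : ∫⁻ z, ε z * p z ∂volume ≠ ∞ := by rw [hint]; exact ENNReal.ofReal_ne_top
  have htv := tvClose_withDensity_of_le (lam := volume) hqm hle hfin
  rw [hint, ENNReal.toReal_ofReal hs1] at htv
  rw [hμ, hγ]
  refine htv.mono ?_
  -- `σ⁻¹ - 1 ≤ 2 (1 - σ)` for `σ ≥ 1/2`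
  rw [inv_eq_one_div, div_sub_one hσ.ne', div_le_iff₀ hσ]
  nlinarith

/-! ### Contractions of a Gaussian vector -/

section MatrixPart

variable {n : ℕ}

/-- The coordinatewise scaled law `⊗ᵢ 𝒩_ℂ(0, σᵢ)` is `2 ∑ (1 − σᵢ)`-close to `γ^n`
(tensorisation of `tvClose_stdComplexGaussian_smul`). [folklore] -/
theorem tvClose_gaussianPi_map_diag_smul (σ : Fin n → ℝ) (h1 : ∀ i, σ i ≤ 1) :
    TVClose ((gaussianPi (Fin n)).map fun (y : Fin n → ℂ) (i : Fin n) => Real.sqrt (σ i) • y i)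
      (gaussianPi (Fin n)) (2 * ∑ i, (1 - σ i)) := by
  have hmap : (gaussianPi (Fin n)).map (fun (y : Fin n → ℂ) (i : Fin n) => Real.sqrt (σ i) • y i) =
      Measure.pi fun i => stdComplexGaussian.map fun z : ℂ => Real.sqrt (σ i) • z := by
    rw [gaussianPi, Measure.pi_map_pi]
    exact fun i => (measurable_const_smul (Real.sqrt (σ i))).aemeasurable
  rw [hmap, gaussianPi, Finset.mul_sum]
  haveI : ∀ i, IsProbabilityMeasure (stdComplexGaussian.map fun z : ℂ => Real.sqrt (σ i) • z) :=
    fun i => Measure.isProbabilityMeasure_map (measurable_const_smul (Real.sqrt (σ i))).aemeasurable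
  exact tvClose_pi _ _ fun i => tvClose_stdComplexGaussian_smul (h1 i)

/-- Row `i` of `N'` acting on `x` is the inner product with the conjugate row:
`(N' x)ᵢ = ⟪conj(N'ᵢ), x⟫`. [folklore] -/
theorem mulVec_eq_inner_star_row (N' : Matrix (Fin n) (Fin n) ℂ) (x : Fin n → ℂ) (i : Fin n) :
    (N' *ᵥ x) i = inner ℂ (toLp 2 (star (N' i)) : EuclideanSpace ℂ (Fin n)) (toLp 2 x) := by
  rw [EuclideanSpace.inner_eq_star_dotProduct]
  change N' i ⬝ᵥ x = x ⬝ᵥ star (star (N' i))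
  rw [star_star, dotProduct_comm]

/-- The Gram matrix of the conjugate rows is `N' N'ᴴ`:
`⟪conj(N'ᵢ), conj(N'ⱼ)⟫ = (N' N'ᴴ)ᵢⱼ`. [folklore] -/
theorem inner_star_row_star_row (N' : Matrix (Fin n) (Fin n) ℂ) (i j : Fin n) :
    inner ℂ (toLp 2 (star (N' i)) : EuclideanSpace ℂ (Fin n)) (toLp 2 (star (N' j))) =
      (N' * N'ᴴ) i j := by
  rw [EuclideanSpace.inner_eq_star_dotProduct, Matrix.mul_apply]
  change star (N' j) ⬝ᵥ star (star (N' i)) = _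
  rw [star_star, dotProduct]
  refine Finset.sum_congr rfl fun l _ => ?_
  rw [Matrix.conjTranspose_apply, Pi.star_apply, mul_comm]

/-- For a matrix `N'` whose rows are pairwise orthogonal with squared norms `σᵢ > 0`
(`N' N'ᴴ = diag σ`), the law of `N' x`, `x ∼ γ^n`, is the coordinatewise scaled law
`⊗ᵢ 𝒩_ℂ(0, σᵢ)`. [folklore] -/
theorem gaussianPi_map_mulVec_of_mul_conjTranspose_eq_diagonal (N' : Matrix (Fin n) (Fin n) ℂ)
    (σ : Fin n → ℝ) (hσ : ∀ i, 0 < σ i)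
    (hN : N' * N'ᴴ = Matrix.diagonal fun i => ((σ i : ℝ) : ℂ)) :
    (gaussianPi (Fin n)).map (fun x => N' *ᵥ x) =
      (gaussianPi (Fin n)).map fun (y : Fin n → ℂ) (i : Fin n) => Real.sqrt (σ i) • y i := by
  -- the normalised conjugate rows form an orthonormal family
  set e : Fin n → EuclideanSpace ℂ (Fin n) :=
    fun i => ((Real.sqrt (σ i))⁻¹ : ℂ) • (toLp 2 (star (N' i)) : EuclideanSpace ℂ (Fin n)) with he_def
  have hsq : ∀ i, (Real.sqrt (σ i) : ℂ) ≠ 0 := fun i => by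
    exact_mod_cast (Real.sqrt_pos.2 (hσ i)).ne'
  have he : Orthonormal ℂ e := by
    rw [orthonormal_iff_ite]
    intro i j
    simp only [he_def, inner_smul_left, inner_smul_right, inner_star_row_star_row, hN,
      Matrix.diagonal_apply]
    by_cases hij : i = j
    · subst hij
      rw [if_pos rfl, if_pos rfl]
      have hs : ((Real.sqrt (σ i) : ℂ)) * (Real.sqrt (σ i) : ℂ) = (σ i : ℂ) := by
        rw [← Complex.ofReal_mul, Real.mul_self_sqrt (hσ i).le]
      rw [map_inv₀, Complex.conj_ofReal, ← hs]
      have hc := hsq i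
      field_simp
    · rw [if_neg hij, if_neg hij, mul_zero, mul_zero]
  -- `N' x = (√σᵢ ⟪eᵢ, x⟫)ᵢ`
  have hfun : (fun x : Fin n → ℂ => N' *ᵥ x) =
      (fun (y : Fin n → ℂ) (i : Fin n) => Real.sqrt (σ i) • y i) ∘
        (fun z : EuclideanSpace ℂ (Fin n) => fun i => inner ℂ (e i) z) ∘ (toLp 2) := by
    funext x; funext i
    simp only [Function.comp_apply, he_def, inner_smul_left, map_inv₀, Complex.conj_ofReal,
      mulVec_eq_inner_star_row, Complex.real_smul]
    rw [← mul_assoc, mul_inv_cancel₀ (hsq i), one_mul]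
  have hm1 : Measurable fun (y : Fin n → ℂ) (i : Fin n) => Real.sqrt (σ i) • y i :=
    measurable_pi_lambda _ fun i => (measurable_const_smul (Real.sqrt (σ i))).comp (measurable_pi_apply i)
  have hm2 : Measurable fun z : EuclideanSpace ℂ (Fin n) => fun i => inner ℂ (e i) z :=
    measurable_pi_lambda _ fun i => (continuous_const.inner continuous_id).measurable
  rw [hfun, ← Measure.map_map hm1 (hm2.comp (measurable_toLp_two _)),
    ← Measure.map_map hm2 (measurable_toLp_two _)]
  change ((gaussianEuc (Fin n)).map _).map _ = _
  rw [gaussianEuc_map_orthonormal_repr he]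

/-- The eigenvalues of `N Nᴴ` lie in `[0, 1]` when `1 − N Nᴴ` is positive semidefinite.
[folklore] -/
theorem eigenvalues_mul_conjTranspose_le_one (N : Matrix (Fin n) (Fin n) ℂ)
    (hN : (1 - N * Nᴴ).PosSemidef) (i : Fin n) :
    (Matrix.isHermitian_mul_conjTranspose_self N).eigenvalues i ≤ 1 := by
  set hS := Matrix.isHermitian_mul_conjTranspose_self N
  set v : Fin n → ℂ := ⇑(hS.eigenvectorBasis i) with hv
  rw [hS.eigenvalues_eq i]
  have hpsd := hN.re_dotProduct_nonneg v
  rw [Matrix.sub_mulVec, Matrix.one_mulVec, dotProduct_sub, map_sub] at hpsd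
  have hvv : RCLike.re (star v ⬝ᵥ v) = 1 := by
    have h1 : inner ℂ (hS.eigenvectorBasis i) (hS.eigenvectorBasis i) = ((1:ℝ) : ℂ) := by
      rw [inner_self_eq_norm_sq_to_K, hS.eigenvectorBasis.orthonormal.1 i]; norm_num
    rw [EuclideanSpace.inner_eq_star_dotProduct, dotProduct_comm] at h1
    change star v ⬝ᵥ v = _ at h1
    rw [h1]; simp
  rw [hvv] at hpsd
  change RCLike.re (star v ⬝ᵥ ((N * Nᴴ) *ᵥ v)) ≤ 1
  linarith

/-- `∑ᵢ σᵢ = tr(N Nᴴ) = ∑ᵢⱼ |Nᵢⱼ|²`. [folklore] -/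
theorem sum_eigenvalues_mul_conjTranspose (N : Matrix (Fin n) (Fin n) ℂ) :
    ∑ i, (Matrix.isHermitian_mul_conjTranspose_self N).eigenvalues i = ∑ i, ∑ j, ‖N i j‖ ^ 2 := by
  set hS := Matrix.isHermitian_mul_conjTranspose_self N
  have h := hS.trace_eq_sum_eigenvalues
  have htr : (N * Nᴴ).trace = ((∑ i, ∑ j, ‖N i j‖ ^ 2 : ℝ) : ℂ) := by
    simp only [Matrix.trace, Matrix.diag, Matrix.mul_apply, Matrix.conjTranspose_apply]
    push_cast
    refine Finset.sum_congr rfl fun i _ => Finset.sum_congr rfl fun j _ => ?_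
    rw [Complex.star_def, Complex.mul_conj, Complex.normSq_eq_norm_sq]
    push_cast
    ring
  have h3 : ((∑ i, ∑ j, ‖N i j‖ ^ 2 : ℝ) : ℂ) = ((∑ i, hS.eigenvalues i : ℝ) : ℂ) := by
    rw [← htr, h]; push_cast; rfl
  exact_mod_cast h3.symm

/-- **Total variation between a contracted Gaussian vector and the standard one.** For an
`n × n` complex matrix `N` with `N Nᴴ ≤ 1` and `x ∼ γ^n`,
`‖Law(N x) − γ^n‖_TV ≤ 2 tr(1 − N Nᴴ) = 2(n − ∑ᵢⱼ |Nᵢⱼ|²)`. (A weak form of the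
Devroye–Mehrabian–Reddad Gaussian total-variation bound; proved via the spectral theorem,
unitary invariance and tensorisation.) [cite: DevroyeMehrabianReddad2018, Thm. 1.1 (weakened: trace bound, constant 2)] -/
theorem tvClose_gaussianPi_map_mulVec (N : Matrix (Fin n) (Fin n) ℂ) (hN : (1 - N * Nᴴ).PosSemidef) :
    TVClose ((gaussianPi (Fin n)).map fun x => N *ᵥ x) (gaussianPi (Fin n))
      (2 * (n - ∑ i, ∑ j, ‖N i j‖ ^ 2)) := by
  set hS := Matrix.isHermitian_mul_conjTranspose_self N
  have hSpsd : (N * Nᴴ).PosSemidef := Matrix.posSemidef_self_mul_conjTranspose N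
  set σ : Fin n → ℝ := hS.eigenvalues with hσdef
  have h0 : ∀ i, 0 ≤ σ i := fun i => hSpsd.eigenvalues_nonneg i
  have h1 : ∀ i, σ i ≤ 1 := fun i => eigenvalues_mul_conjTranspose_le_one N hN i
  have hsum : ∑ i, σ i = ∑ i, ∑ j, ‖N i j‖ ^ 2 := sum_eigenvalues_mul_conjTranspose N
  have hmeasN : ∀ M : Matrix (Fin n) (Fin n) ℂ, Measurable fun x : Fin n → ℂ => M *ᵥ x :=
    fun M => (Matrix.mulVecLin M).continuous_of_finiteDimensional.measurable
  haveI : IsProbabilityMeasure ((gaussianPi (Fin n)).map fun x => N *ᵥ x) :=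
    Measure.isProbabilityMeasure_map (hmeasN N).aemeasurable
  -- trivial case: some eigenvalue vanishes
  by_cases hz : ∃ i, σ i = 0
  · obtain ⟨i₀, hi₀⟩ := hz
    refine (TVClose.of_prob _ _).mono ?_
    have hone : (1:ℝ) ≤ ∑ i, (1 - σ i) := by
      have := Finset.single_le_sum (f := fun i => 1 - σ i) (fun i _ => sub_nonneg.2 (h1 i))
        (Finset.mem_univ i₀)
      simpa [hi₀] using this
    rw [Finset.sum_sub_distrib, Finset.sum_const, Finset.card_univ, Fintype.card_fin] at hone
    simp only [nsmul_eq_mul, mul_one] at hone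
    rw [← hsum]; linarith
  · push Not at hz
    have hpos : ∀ i, 0 < σ i := fun i => lt_of_le_of_ne (h0 i) (Ne.symm (hz i))
    -- diagonalise: `U† (N Nᴴ) U = diag σ`
    set U := hS.eigenvectorUnitary with hU
    set N' : Matrix (Fin n) (Fin n) ℂ := star (U : Matrix (Fin n) (Fin n) ℂ) * N with hN'
    have hUN' : (U : Matrix (Fin n) (Fin n) ℂ) * N' = N := by
      rw [hN', ← mul_assoc, Matrix.mem_unitaryGroup_iff.1 U.2, one_mul]
    have hdiag : N' * N'ᴴ = Matrix.diagonal fun i => ((σ i : ℝ) : ℂ) := by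
      have h := hS.conjStarAlgAut_star_eigenvectorUnitary
      rw [Unitary.conjStarAlgAut_star_apply, ← hU, Matrix.star_eq_conjTranspose] at h
      rw [hN', Matrix.conjTranspose_mul, Matrix.star_eq_conjTranspose,
        Matrix.conjTranspose_conjTranspose]
      have hassoc : (U : Matrix (Fin n) (Fin n) ℂ)ᴴ * N * (Nᴴ * (U : Matrix (Fin n) (Fin n) ℂ)) =
          (U : Matrix (Fin n) (Fin n) ℂ)ᴴ * (N * Nᴴ) * (U : Matrix (Fin n) (Fin n) ℂ) := by
        simp only [Matrix.mul_assoc]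
      rw [hassoc, h]
      rfl
    have hlaw : (gaussianPi (Fin n)).map (fun x => N *ᵥ x) =
        ((gaussianPi (Fin n)).map (fun x => N' *ᵥ x)).map
          fun x => (U : Matrix (Fin n) (Fin n) ℂ) *ᵥ x := by
      rw [Measure.map_map (hmeasN _) (hmeasN _)]
      congr 1
      funext x
      simp only [Function.comp_apply, Matrix.mulVec_mulVec, hUN']
    rw [hlaw, gaussianPi_map_mulVec_of_mul_conjTranspose_eq_diagonal N' σ hpos hdiag]
    have key := (tvClose_gaussianPi_map_diag_smul σ h1).map (hmeasN (U : Matrix (Fin n) (Fin n) ℂ))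
    rw [gaussianPi_map_unitary_mulVec U] at key
    refine key.mono (le_of_eq ?_)
    rw [Finset.sum_sub_distrib, Finset.sum_const, Finset.card_univ, Fintype.card_fin, hsum]
    simp

end MatrixPart

end Literature.Probability.RandomMatrix
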